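import Summits.NavierStokesRegularity.NavierStokesRegularity.Theorems.AxisymmetricExtremalityAxisymmetricKatoGlobalStubSeregin2020TypeIILemma22ShrinkingLevels
import Summits.NavierStokesRegularity.NavierStokesRegularity.Theorems.AxisymmetricExtremalityAxisymmetricKatoGlobalStubSeregin2020TypeIILemma22GradientMeasurability
import Summits.NavierStokesRegularity.NavierStokesRegularity.Theorems.AxisymmetricExtremalityAxisymmetricKatoGlobalStubSeregin2020TypeIILemma22SublevelEnergy
import Summits.NavierStokesRegularity.NavierStokesRegularity.Theorems.AxisymmetricExtremalityAxisymmetricKatoGlobalStubSeregin2020TypeIILemma22DriftBounds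
import HarnessLib

/-!
# Seregin 2020, Lemma 2.2 (after Nazarov–Uraltseva 2012): the energy bound (3.12) with N–U's
# shape parameters — `∫∫_{Q_ρ^{1,θ} ∩ {Φ < l}} |∇Φ|² ≤ C(λ, θmax, N) l² ρ³`

Helper toward the stub `stub_seregin2020TypeII` of the crux `AxisymmetricKatoGlobal` (= the named
fact `Literature.Analysis.FluidPDE.Seregin2020_axisymmetricSingularPoint_typeII`, Seregin 2020,
Thm 2.1), reduced in the tree to the written-out hypothesis `hWH′` (= N–U 2012 Lemma 4.2 for the
class 𝒱), attacked through the cell's De Giorgi skeleton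
`Cruxes/AxisymmetricKatoGlobal/Seregin2020Lemma22ExpansionOfPositivity.lean` (atom
`stub_L33_shrinking`). The sibling `…Lemma22SublevelEnergy` bounds the dissipation on a
sublevel set by the four terms of the energy inequality; `…Lemma22DriftBounds` bounds the two
drift integrals. Here the bound is specialised to N–U's geometry — inner radius `ρ ≥ R/4`, outer
radius `λ'ρ` with `λ' = (1+λ)/2`, `λρ ≤ 2R`, time window `θρ²`, `θ ≤ θmax` — and the constant is
made scale free:

* `rpow_shape_identity` — `(ρ²)^{1/4} (ρ²)^{1/12} (ρ⁵)^{2/3} = ρ⁴`;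
* `lintegral_fderiv_sq_sublevel_le_shape` — (3.12) in the form consumed by the shrinking-levels
  core `shrinkingLevels_measure_le`: for every level `0 < l` with `2l ≤ k`,
  `∫∫_{(]t₀-θρ², t₀[ × B(ρ)) ∩ {Φ < l}} ‖∇Φ‖² ≤ C(λ, θmax, N) l² ρ³` (the constant depends
  also on the absolute constants `C_g` of the radial cut-off, `C₁` of `∫_B 1/|x'|`, and `|B₁|`).

## References

* A. I. Nazarov, N. N. Uraltseva, St. Petersburg Math. J. 23 (2012) 93–115 = arXiv:1011.1888,
  §3, (3.12) and the proof of Lemma 3.3, Remarks 5 and 9. [NazarovUraltseva2012]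
* G. Seregin, Anal. Math. Phys. 10 (2020), Paper 46 = arXiv:2006.04140, Lemma 2.2. [Seregin2020]
-/

-- the problem directory repeats the summit name (D-0017); core's `dupNamespace` linter fires
set_option linter.dupNamespace false

noncomputable section

open MeasureTheory Set Function Filter Topology Metric Module
open scoped NNReal ENNReal

namespace Summit.NavierStokesRegularity.NavierStokesRegularity.Theorems.AxisymmetricKatoGlobal.EulerScaling

open Literature.Analysis.FluidPDE Literature.Analysis.FluidPDE.LeiZhang2011

/-- `(ρ²)^{1/4} (ρ²)^{1/12} (ρ⁵)^{2/3} = ρ⁴` for `ρ > 0`. [folklore] -/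
theorem rpow_shape_identity {ρ : ℝ} (hρ : 0 < ρ) :
    (ρ ^ 2) ^ (1 / 4 : ℝ) * (ρ ^ 2) ^ (1 / 12 : ℝ) * (ρ ^ 5) ^ (2 / 3 : ℝ) = ρ ^ 4 := by
  have h2 : (ρ ^ 2 : ℝ) = ρ ^ (2 : ℝ) := by
    rw [show (2 : ℝ) = ((2 : ℕ) : ℝ) by norm_num, Real.rpow_natCast]
  have h5 : (ρ ^ 5 : ℝ) = ρ ^ (5 : ℝ) := by
    rw [show (5 : ℝ) = ((5 : ℕ) : ℝ) by norm_num, Real.rpow_natCast]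
  have h4 : (ρ ^ 4 : ℝ) = ρ ^ (4 : ℝ) := by
    rw [show (4 : ℝ) = ((4 : ℕ) : ℝ) by norm_num, Real.rpow_natCast]
  have e1 : (ρ ^ 2) ^ (1 / 4 : ℝ) = ρ ^ (1 / 2 : ℝ) := by
    rw [h2, ← Real.rpow_mul hρ.le]; norm_num
  have e2 : (ρ ^ 2) ^ (1 / 12 : ℝ) = ρ ^ (1 / 6 : ℝ) := by
    rw [h2, ← Real.rpow_mul hρ.le]; norm_num
  have e3 : (ρ ^ 5) ^ (2 / 3 : ℝ) = ρ ^ (10 / 3 : ℝ) := by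
    rw [h5, ← Real.rpow_mul hρ.le]; norm_num
  rw [e1, e2, e3, ← Real.rpow_add hρ, ← Real.rpow_add hρ, h4]
  norm_num

/-- The drift integral bound in N–U's shape parameters: with `R ≤ 4ρ`, `θ ≤ θmax`,
`(N R²)^{1/4} (R²)^{1/12} (θ |B₁| λ'³ ρ⁵)^{2/3} ≤ c_U ρ⁴`,
`c_U = (16N)^{1/4} 16^{1/12} (θmax |B₁| λ'³)^{2/3}`. [folklore] -/
theorem drift_real_bound {N' R ρ θ θmax V₁ lam' : ℝ} (hN : 0 ≤ N') (hR : 0 < R) (hρ : 0 < ρ)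
    (hR4 : R ≤ 4 * ρ) (hθ : 0 < θ) (hθ2 : θ ≤ θmax) (hV₁ : 0 ≤ V₁) (hlam' : 0 < lam') :
    (N' * R ^ 2) ^ (1 / 4 : ℝ) * (R ^ 2) ^ (1 / 12 : ℝ) * (θ * V₁ * lam' ^ 3 * ρ ^ 5) ^ (2 / 3 : ℝ) ≤
      ((16 * N') ^ (1 / 4 : ℝ) * (16 : ℝ) ^ (1 / 12 : ℝ) * (θmax * V₁ * lam' ^ 3) ^ (2 / 3 : ℝ)) *
        ρ ^ 4 := by
  have hR2 : R ^ 2 ≤ 16 * ρ ^ 2 := by nlinarith [hR4, hR.le]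
  have hθmax : 0 ≤ θmax := hθ.le.trans hθ2
  have h1 : (N' * R ^ 2) ^ (1 / 4 : ℝ) ≤ (16 * N') ^ (1 / 4 : ℝ) * (ρ ^ 2) ^ (1 / 4 : ℝ) := by
    rw [← Real.mul_rpow (by positivity) (by positivity)]
    refine Real.rpow_le_rpow (by positivity) ?_ (by norm_num)
    calc N' * R ^ 2 ≤ N' * (16 * ρ ^ 2) := mul_le_mul_of_nonneg_left hR2 hN
      _ = 16 * N' * ρ ^ 2 := by ring
  have h2 : (R ^ 2) ^ (1 / 12 : ℝ) ≤ (16 : ℝ) ^ (1 / 12 : ℝ) * (ρ ^ 2) ^ (1 / 12 : ℝ) := by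
    rw [← Real.mul_rpow (by positivity) (by positivity)]
    exact Real.rpow_le_rpow (by positivity) hR2 (by norm_num)
  have h3 : (θ * V₁ * lam' ^ 3 * ρ ^ 5) ^ (2 / 3 : ℝ) ≤
      (θmax * V₁ * lam' ^ 3) ^ (2 / 3 : ℝ) * (ρ ^ 5) ^ (2 / 3 : ℝ) := by
    rw [← Real.mul_rpow (by positivity) (by positivity)]
    refine Real.rpow_le_rpow (by positivity) ?_ (by norm_num)
    have : θ * V₁ * lam' ^ 3 ≤ θmax * V₁ * lam' ^ 3 := by gcongr
    exact mul_le_mul_of_nonneg_right this (pow_nonneg hρ.le 5)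
  calc (N' * R ^ 2) ^ (1 / 4 : ℝ) * (R ^ 2) ^ (1 / 12 : ℝ) * (θ * V₁ * lam' ^ 3 * ρ ^ 5) ^ (2 / 3 : ℝ)
      ≤ ((16 * N') ^ (1 / 4 : ℝ) * (ρ ^ 2) ^ (1 / 4 : ℝ)) * ((16 : ℝ) ^ (1 / 12 : ℝ) * (ρ ^ 2) ^ (1 / 12 : ℝ)) *
          ((θmax * V₁ * lam' ^ 3) ^ (2 / 3 : ℝ) * (ρ ^ 5) ^ (2 / 3 : ℝ)) :=
        mul_le_mul (mul_le_mul h1 h2 (by positivity) (by positivity)) h3 (by positivity)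
          (by positivity)
    _ = (16 * N') ^ (1 / 4 : ℝ) * (16 : ℝ) ^ (1 / 12 : ℝ) * (θmax * V₁ * lam' ^ 3) ^ (2 / 3 : ℝ) *
          ((ρ ^ 2) ^ (1 / 4 : ℝ) * (ρ ^ 2) ^ (1 / 12 : ℝ) * (ρ ^ 5) ^ (2 / 3 : ℝ)) := by ring
    _ = _ := by rw [rpow_shape_identity hρ]


/-- The bookkeeping of the four terms of (3.12) in N–U's shape parameters (`ρ₁ = λ'ρ`,
`ρ₁ - ρ = (λ'-1)ρ`, `t₀ - a = θρ²`, `|B̄(ρ₁)| = |B₁|λ'³ρ³`): the bracket of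
`lintegral_fderiv_sq_sublevel_le_of_energyClass` is at most `C(λ', θmax, …) l² ρ³`. [folklore] -/
theorem shape_real_algebra {Cg C₁ V₁ lam' θ θmax ρ l cU IU' Iρ' : ℝ} (hCg : 0 ≤ Cg) (hC₁ : 0 ≤ C₁)
    (hV₁ : 0 ≤ V₁) (hlam' : 1 < lam') (hθ : 0 < θ) (hθ2 : θ ≤ θmax) (hρ : 0 < ρ)
    (hIU : IU' ≤ cU * ρ ^ 4) (hIρ : Iρ' = θ * ρ ^ 2 * (C₁ * (4 * lam' ^ 2 * ρ ^ 2))) :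
    8 / 3 * l ^ 2 * (V₁ * lam' ^ 3 * ρ ^ 3 +
        4 * (Cg / ((lam' - 1) * ρ)) ^ 2 * (θ * ρ ^ 2 * (V₁ * lam' ^ 3 * ρ ^ 3)) +
        2 * (Cg / ((lam' - 1) * ρ)) * IU' + 4 * (Cg / ((lam' - 1) * ρ)) * Iρ') ≤
      8 / 3 * (V₁ * lam' ^ 3 + 4 * Cg ^ 2 * θmax * V₁ * lam' ^ 3 / (lam' - 1) ^ 2 +
          2 * Cg * cU / (lam' - 1) + 16 * Cg * C₁ * θmax * lam' ^ 2 / (lam' - 1)) * l ^ 2 * ρ ^ 3 := by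
  have hd0 : 0 < lam' - 1 := by linarith
  have hρ0 : ρ ≠ 0 := hρ.ne'
  have hd0' : lam' - 1 ≠ 0 := hd0.ne'
  have e2 : 4 * (Cg / ((lam' - 1) * ρ)) ^ 2 * (θ * ρ ^ 2 * (V₁ * lam' ^ 3 * ρ ^ 3)) =
      4 * Cg ^ 2 * θ * V₁ * lam' ^ 3 / (lam' - 1) ^ 2 * ρ ^ 3 := by
    field_simp
  have e2' : 4 * Cg ^ 2 * θ * V₁ * lam' ^ 3 / (lam' - 1) ^ 2 ≤
      4 * Cg ^ 2 * θmax * V₁ * lam' ^ 3 / (lam' - 1) ^ 2 := by gcongr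
  have e3 : 2 * (Cg / ((lam' - 1) * ρ)) * IU' ≤ 2 * Cg * cU / (lam' - 1) * ρ ^ 3 := by
    calc 2 * (Cg / ((lam' - 1) * ρ)) * IU' ≤ 2 * (Cg / ((lam' - 1) * ρ)) * (cU * ρ ^ 4) :=
          mul_le_mul_of_nonneg_left hIU (by positivity)
      _ = 2 * Cg * cU / (lam' - 1) * ρ ^ 3 := by field_simp
  have e4 : 4 * (Cg / ((lam' - 1) * ρ)) * Iρ' = 16 * Cg * C₁ * θ * lam' ^ 2 / (lam' - 1) * ρ ^ 3 := by
    rw [hIρ]; field_simp; ring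
  have e4' : 16 * Cg * C₁ * θ * lam' ^ 2 / (lam' - 1) ≤ 16 * Cg * C₁ * θmax * lam' ^ 2 / (lam' - 1) := by
    gcongr
  rw [e2, e4]
  have hρ3 : 0 ≤ ρ ^ 3 := by positivity
  have hl2 : 0 ≤ 8 / 3 * l ^ 2 := by positivity
  have hsum : V₁ * lam' ^ 3 * ρ ^ 3 + 4 * Cg ^ 2 * θ * V₁ * lam' ^ 3 / (lam' - 1) ^ 2 * ρ ^ 3 +
      2 * (Cg / ((lam' - 1) * ρ)) * IU' + 16 * Cg * C₁ * θ * lam' ^ 2 / (lam' - 1) * ρ ^ 3 ≤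
      (V₁ * lam' ^ 3 + 4 * Cg ^ 2 * θmax * V₁ * lam' ^ 3 / (lam' - 1) ^ 2 +
          2 * Cg * cU / (lam' - 1) + 16 * Cg * C₁ * θmax * lam' ^ 2 / (lam' - 1)) * ρ ^ 3 := by
    nlinarith [mul_le_mul_of_nonneg_right e2' hρ3, mul_le_mul_of_nonneg_right e4' hρ3, e3]
  calc _ ≤ 8 / 3 * l ^ 2 * ((V₁ * lam' ^ 3 + 4 * Cg ^ 2 * θmax * V₁ * lam' ^ 3 / (lam' - 1) ^ 2 +
          2 * Cg * cU / (lam' - 1) + 16 * Cg * C₁ * θmax * lam' ^ 2 / (lam' - 1)) * ρ ^ 3) :=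
        mul_le_mul_of_nonneg_left hsum hl2
    _ = _ := by ring

/-- **Nazarov–Uraltseva 2012, (3.12) with the shape parameters of Lemma 3.3, in Seregin's
class 𝒱.** For `1 < λ ≤ 2`, `0 < θmax` and a drift constant `N` there is `C ≥ 0` such that: for
every `Φ ≥ 0` jointly measurable with `C¹` slices for a.e. `t ∈ ]-R², 0[`, every drift `U`
a.e.-strongly measurable on the slab `]-R², 0[ × B(2R)` with
`∫_{-R²}^0 (∫_{B(2R)} |U|³)^{4/3} ≤ N R²`, the energy-inequality class at the axis level `k`
(hypothesis `hEC` = `EnergyClass Φ U k R` of the De Giorgi skeleton, written out with the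
right-hand side parenthesised as `η t₁ (∫ …) + ∫∫ …`), and every cylinder
`Q = ]t₀ - θρ², t₀[ × B(ρ)` with `R/4 ≤ ρ`, `λρ ≤ 2R`, `0 < θ ≤ θmax`, `t₀ ≤ 0`,
`-R² < t₀ - θρ²`, and every level `0 < l`, `2l ≤ k`:
`∫∫_{Q ∩ {Φ < l}} ‖∇Φ‖² ≤ C l² ρ³`. [cite: NazarovUraltseva2012, (3.12), proof of Lemma 3.3, Remarks 5, 9] -/
theorem lintegral_fderiv_sq_sublevel_le_shape :
    ∀ (lam θmax : ℝ) (N : ℝ≥0), 1 < lam → lam ≤ 2 → 0 < θmax →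
    ∃ C : ℝ, 0 ≤ C ∧
    ∀ (Φ : ℝ → EuclideanSpace ℝ (Fin 3) → ℝ)
      (U : ℝ → EuclideanSpace ℝ (Fin 3) → EuclideanSpace ℝ (Fin 3)) (k R : ℝ),
      0 < R → Measurable (uncurry Φ) → (∀ t x, 0 ≤ Φ t x) →
      AEStronglyMeasurable (uncurry U)
        (volume.restrict (Ioo (-R ^ 2) 0 ×ˢ ball (0 : EuclideanSpace ℝ (Fin 3)) (2 * R))) →
      (∫⁻ s in Ioo (-R ^ 2) 0, (∫⁻ y in ball (0 : EuclideanSpace ℝ (Fin 3)) (2 * R),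
        ‖U s y‖ₑ ^ (3 : ℕ)) ^ (4 / 3 : ℝ) ≤ (N : ℝ≥0∞) * ENNReal.ofReal R ^ 2) →
      (∀ (H : ℝ → ℝ), ContDiff ℝ 2 H → (∀ v, deriv H v ≤ 0) → (∀ v, 0 ≤ H v) →
        (∀ v, 0 ≤ deriv (deriv H) v) → (∀ v, deriv H v ^ 2 ≤ 2 * H v * deriv (deriv H) v) →
        (∀ v, k ≤ v → H v = 0) →
        ∀ (Θ : EuclideanSpace ℝ (Fin 3) → ℝ), ContDiff ℝ 1 Θ → HasCompactSupport Θ →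
          tsupport Θ ⊆ ball (0 : EuclideanSpace ℝ (Fin 3)) (2 * R) →
        ∀ (η : ℝ → ℝ), ContDiff ℝ 1 η → (∀ s, 0 ≤ η s) →
        ∀ (t₁ t₂ : ℝ), -R ^ 2 < t₁ → t₁ ≤ t₂ → t₂ < 0 →
          ENNReal.ofReal (η t₂ * ∫ x, H (Φ t₂ x) * Θ x ^ 2) +
            ∫⁻ z in Icc t₁ t₂ ×ˢ (univ : Set (EuclideanSpace ℝ (Fin 3))), ENNReal.ofReal
              (1 / 2 * η z.1 * (deriv (deriv H) (Φ z.1 z.2) * ‖gradient (Φ z.1) z.2‖ ^ 2 *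
                Θ z.2 ^ 2))
          ≤ ENNReal.ofReal (η t₁ * (∫ x, H (Φ t₁ x) * Θ x ^ 2) +
              ∫ z in Icc t₁ t₂ ×ˢ (univ : Set (EuclideanSpace ℝ (Fin 3))),
                (4 * η z.1 * (H (Φ z.1 z.2) * ‖gradient Θ z.2‖ ^ 2) +
                  η z.1 * (H (Φ z.1 z.2) * inner ℝ (U z.1 z.2) (gradient (fun y => Θ y ^ 2) z.2)) +
                  η z.1 * (2 / cylRadius z.2 *
                    (H (Φ z.1 z.2) * fderiv ℝ (fun y => Θ y ^ 2) z.2 (eR z.2))) +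
                  |deriv η z.1| * (H (Φ z.1 z.2) * Θ z.2 ^ 2)))) →
    ∀ (ρ θ t₀ l : ℝ), R / 4 ≤ ρ → lam * ρ ≤ 2 * R → 0 < θ → θ ≤ θmax → t₀ ≤ 0 →
      -R ^ 2 < t₀ - θ * ρ ^ 2 → 0 < l → 2 * l ≤ k →
      ∫⁻ z in (Ioo (t₀ - θ * ρ ^ 2) t₀ ×ˢ ball (0 : EuclideanSpace ℝ (Fin 3)) ρ) ∩
          {z | Φ z.1 z.2 < l}, ‖fderiv ℝ (Φ z.1) z.2‖ₑ ^ 2 ≤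
        ENNReal.ofReal (C * l ^ 2 * ρ ^ 3) := by
  intro lam θmax N hlam hlam2 hθmax
  -- ### absolute constants
  obtain ⟨Cg, hCg0, hCg⟩ := exists_norm_fderiv_radialCutoff_le
  obtain ⟨C₁, hC₁⟩ := lintegral_inv_cylRadius_rpow_ball_le 1 (by norm_num) (by norm_num)
  set V₁ : ℝ := (volume (ball (0 : EuclideanSpace ℝ (Fin 3)) 1)).toReal with hV₁
  have hB1fin : volume (ball (0 : EuclideanSpace ℝ (Fin 3)) 1) < ∞ := measure_ball_lt_top
  have hV₁0 : 0 ≤ V₁ := ENNReal.toReal_nonneg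
  set lam' : ℝ := (1 + lam) / 2 with hlam'
  have hlam'1 : 1 < lam' := by rw [hlam']; linarith
  have hlam'2 : lam' < lam := by rw [hlam']; linarith
  have hd0 : 0 < lam' - 1 := by linarith
  set N' : ℝ := (N : ℝ) with hN'
  have hN'0 : 0 ≤ N' := N.coe_nonneg
  set cU : ℝ := (16 * N') ^ (1 / 4 : ℝ) * (16 : ℝ) ^ (1 / 12 : ℝ) *
    (θmax * V₁ * lam' ^ 3) ^ (2 / 3 : ℝ) with hcU
  have hcU0 : 0 ≤ cU := by positivity
  -- the four shape constants
  set T1 : ℝ := V₁ * lam' ^ 3 with hT1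
  set T2 : ℝ := 4 * Cg ^ 2 * θmax * V₁ * lam' ^ 3 / (lam' - 1) ^ 2 with hT2
  set T3 : ℝ := 2 * Cg * cU / (lam' - 1) with hT3
  set T4 : ℝ := 16 * Cg * (C₁ : ℝ) * θmax * lam' ^ 2 / (lam' - 1) with hT4
  refine ⟨8 / 3 * (T1 + T2 + T3 + T4), by positivity, ?_⟩
  intro Φ U k R hR hΦm hΦ0 hU hdrift hEC ρ θ t₀ l hρR hlamρ hθ hθ2 ht₀ hbot hl hlk
  -- ### geometry
  have hρ : 0 < ρ := by linarith
  set a : ℝ := t₀ - θ * ρ ^ 2 with ha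
  have hat : a < t₀ := by
    have : 0 < θ * ρ ^ 2 := by positivity
    rw [ha]; linarith
  have hta : t₀ - a = θ * ρ ^ 2 := by rw [ha]; ring
  set ρ₁ : ℝ := lam' * ρ with hρ₁def
  have hρρ₁ : ρ < ρ₁ := by
    rw [hρ₁def]; nlinarith
  have hρ₁pos : 0 < ρ₁ := hρ.trans hρρ₁
  have hρ₁R : ρ₁ < 2 * R := by
    rw [hρ₁def]
    calc lam' * ρ < lam * ρ := mul_lt_mul_of_pos_right hlam'2 hρ
      _ ≤ 2 * R := hlamρ
  have hdiff : ρ₁ - ρ = (lam' - 1) * ρ := by rw [hρ₁def]; ring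
  have hR4 : R ≤ 4 * ρ := by linarith
  -- the sub-cylinder `W = [a, t₀[ × B̄(ρ₁)` of the slab
  set W : Set (ℝ × EuclideanSpace ℝ (Fin 3)) :=
    Ico a t₀ ×ˢ closedBall (0 : EuclideanSpace ℝ (Fin 3)) ρ₁ with hW
  have hWsub : W ⊆ Ioo (-R ^ 2) 0 ×ˢ ball (0 : EuclideanSpace ℝ (Fin 3)) (2 * R) :=
    prod_mono (fun s hs => ⟨hbot.trans_le hs.1, hs.2.trans_le ht₀⟩) (closedBall_subset_ball hρ₁R)
  have hWvol : volume W = ENNReal.ofReal (θ * ρ ^ 2) * (ENNReal.ofReal (ρ₁ ^ 3) *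
      volume (ball (0 : EuclideanSpace ℝ (Fin 3)) 1)) := by
    rw [hW, Measure.volume_eq_prod, Measure.prod_prod, Real.volume_Ico, hta,
      Measure.addHaar_closedBall volume _ hρ₁pos.le, finrank_euclideanSpace_fin]
  have hWreal : (volume W).toReal = θ * V₁ * lam' ^ 3 * ρ ^ 5 := by
    rw [hWvol, ENNReal.toReal_mul, ENNReal.toReal_mul, ENNReal.toReal_ofReal (by positivity),
      ENNReal.toReal_ofReal (by positivity), hV₁, hρ₁def]
    ring
  have hVK : (volume (closedBall (0 : EuclideanSpace ℝ (Fin 3)) ρ₁)).toReal = V₁ * lam' ^ 3 * ρ ^ 3 := by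
    rw [Measure.addHaar_closedBall volume _ hρ₁pos.le, finrank_euclideanSpace_fin, ENNReal.toReal_mul,
      ENNReal.toReal_ofReal (by positivity), hV₁, hρ₁def]
    ring
  -- ### the drift and axis integrals
  set IU : ℝ≥0∞ := ((N : ℝ≥0∞) * ENNReal.ofReal R ^ 2) ^ (1 / 4 : ℝ) *
    ENNReal.ofReal (R ^ 2) ^ (1 / 12 : ℝ) * volume W ^ (2 / 3 : ℝ) with hIU
  have hIUle : ∫⁻ z in W, ‖U z.1 z.2‖ₑ ≤ IU := lintegral_enorm_drift_le hU hdrift hWsub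
  have hWfin : volume W < ∞ := by
    rw [hWvol]
    exact ENNReal.mul_lt_top ENNReal.ofReal_lt_top (ENNReal.mul_lt_top ENNReal.ofReal_lt_top hB1fin)
  have hIUfin : IU ≠ ∞ := by
    refine ENNReal.mul_ne_top (ENNReal.mul_ne_top ?_ ?_) ?_
    · exact (ENNReal.rpow_lt_top_of_nonneg (by norm_num)
        (ENNReal.mul_ne_top ENNReal.coe_ne_top (ENNReal.pow_ne_top ENNReal.ofReal_ne_top))).ne
    · exact (ENNReal.rpow_lt_top_of_nonneg (by norm_num) ENNReal.ofReal_ne_top).ne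
    · exact (ENNReal.rpow_lt_top_of_nonneg (by norm_num) hWfin.ne).ne
  have hIUreal : IU.toReal = (N' * R ^ 2) ^ (1 / 4 : ℝ) * (R ^ 2) ^ (1 / 12 : ℝ) *
      (θ * V₁ * lam' ^ 3 * ρ ^ 5) ^ (2 / 3 : ℝ) := by
    rw [hIU, ENNReal.toReal_mul, ENNReal.toReal_mul, ← ENNReal.toReal_rpow, ← ENNReal.toReal_rpow,
      ← ENNReal.toReal_rpow, ENNReal.toReal_mul, ENNReal.toReal_pow, ENNReal.toReal_ofReal hR.le,
      ENNReal.toReal_ofReal (by positivity), hWreal, ENNReal.coe_toReal]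
  have hIUbound : IU.toReal ≤ cU * ρ ^ 4 := by
    rw [hIUreal, hcU]
    exact drift_real_bound hN'0 hR hρ hR4 hθ hθ2 hV₁0 (by linarith)
  set Iϱ : ℝ≥0∞ := ENNReal.ofReal (t₀ - a) * ((C₁ : ℝ≥0∞) * ENNReal.ofReal ((2 * ρ₁) ^ 2)) with hIϱ
  have hIϱle : ∫⁻ z in W, ENNReal.ofReal (cylRadius z.2)⁻¹ ≤ Iϱ :=
    lintegral_inv_cylRadius_Ico_closedBall_le hC₁ hρ₁pos
  have hIϱfin : Iϱ ≠ ∞ :=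
    ENNReal.mul_ne_top ENNReal.ofReal_ne_top (ENNReal.mul_ne_top ENNReal.coe_ne_top ENNReal.ofReal_ne_top)
  have hIϱreal : Iϱ.toReal = θ * ρ ^ 2 * ((C₁ : ℝ) * (4 * lam' ^ 2 * ρ ^ 2)) := by
    rw [hIϱ, ENNReal.toReal_mul, ENNReal.toReal_mul, ENNReal.toReal_ofReal (by linarith), hta,
      ENNReal.toReal_ofReal (by positivity), ENNReal.coe_toReal, hρ₁def]
    ring
  -- ### the energy bound and the constant bookkeeping
  have hmain := lintegral_fderiv_sq_sublevel_le_of_energyClass Φ U k R hΦm hΦ0 hU hEC hρ hρρ₁ hρ₁R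
    hbot hat ht₀ hl hlk hCg0 (hCg ρ ρ₁ hρ.le hρρ₁) hIUfin hIϱfin hIUle hIϱle
  refine hmain.trans (ENNReal.ofReal_le_ofReal ?_)
  rw [hVK, hta, hdiff]
  exact shape_real_algebra hCg0 C₁.coe_nonneg hV₁0 hlam'1 hθ hθ2 hρ hIUbound hIϱreal

end Summit.NavierStokesRegularity.NavierStokesRegularity.Theorems.AxisymmetricKatoGlobal.EulerScaling

end
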